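/- Width seat `ym-line-sfw-p2-w5` (prover-ym-line-sfw-p2-w5-g18-0), free hands on planner ym-idea-2 g16's LINE-19 task board (STUB-PLAN-S4b §11,
toward the FREE item `HodgeCaccioppoli`; crux `AllWindowsColdBox.BoxHighWindowsSU22` = stmt-QuantumFields-24004 / 24335, stub S4b):
the exact discrete Caccioppoli IDENTITY for a sum-of-local-squares quadratic form, and its instance for the Hodge system column. -/
import Summits.QuantumFields.YangMills.Theorems.AllWindowsColdBoxBoxHighLineGradKernelEnergy

/-!
# LINE-19 S4b §11: the discrete Caccioppoli identity for `hodgeQ = Σ_p λ_pλ_pᵀ + Σ_x g_x g_xᵀ`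

The typed §11 target `HodgeCaccioppoli` (✓`…BoxHighLineGradKernelEnergy`; FREE on the task board) is a discrete Caccioppoli inequality for
the column `u = (hodgeQ H)⁻¹ δ_e`, which is `hodgeQ`-harmonic off `e`.  This file proves the exact algebra behind every such inequality, for an
arbitrary cutoff `χ`, leaving only the choice of `χ` and the support bookkeeping to the `HodgeCaccioppoli` prover:

* `sq_localForm_cutoff_eq` (pure algebra, any finite index type): for a local functional `a`, a cutoff `χ` and a vector `u`,
  `(Σ_i a_i χ_i u_i)² = (Σ_i a_i χ_i² u_i)(Σ_j a_j u_j) − ½ Σ_i Σ_j a_i a_j u_i u_j (χ_i − χ_j)²`;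
* `dotProduct_hodgeQ_mulVec` : `v·(hodgeQ w) = Σ_p (λ_p·v)(λ_p·w) + Σ_x (g_x·v)(g_x·w)` (bilinear form of ✓`hodgeQ_mulVec`);
* `hodgeQ_mulVec_invRow` : the row `u_{e'} = (hodgeQ⁻¹)_{e e'}` solves `hodgeQ u = δ_e` (`Pi.single e 1`);
* **`hodge_caccioppoli_identity`**: for every cutoff `χ` with `χ e = 0`,
  `Σ_p (λ_p·(χu))² + Σ_x (g_x·(χu))² = −½ [Σ_p Σ_iΣ_j λ_pi λ_pj u_iu_j (χ_i−χ_j)² + Σ_x Σ_iΣ_j g_xi g_xj u_iu_j (χ_i−χ_j)²]`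
  — the curl+gauge energy of the cut-off column is EXACTLY a commutator term supported where `χ` varies across a plaquette / a site star;
  with `χ ≡ 1` on the far plaquettes, `χ ≡ 0` near `e` and `|χ_i − χ_j| ≲ 1/r` across supports inside the annulus this is `HodgeCaccioppoli`
  (the remaining support bookkeeping: `λ_p` lives on the 4 edges of `p`, `g_x` on the 8 edges at `x`).

Everything proved; no definition; standard axioms.  HONEST LABEL: an algebraic helper toward ONE registered stub (S4b) of a critic-PASSed line
on the R2ξ″ RECORD-rung crux 24004 / 24335; `HodgeCaccioppoli` itself remains OPEN; no stub is proved by name, no crux, rung or summit is proved;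
the Yang–Mills mass gap is NOT proved by this file.
-/

set_option autoImplicit false

noncomputable section

open Finset Matrix
open Literature.MathematicalPhysics.QuantumFieldTheory
open Literature.MathematicalPhysics.QuantumFieldTheory.LatticeMaxwell
open Literature.MathematicalPhysics.QuantumFieldTheory.AxialGauge
open Summit.QuantumFields.YangMills.Theorems.WeakCouplingRates
open Summit.QuantumFields.YangMills.Theorems.AllWindowsColdBox

namespace Summit.QuantumFields.YangMills.Theorems.AllWindowsColdBoxBoxHighLine

/-! ## The algebraic identity for one local functional -/

/-- **Cutoff identity for one local square**: `(Σ_i a_i χ_i u_i)² = (Σ_i a_i χ_i² u_i)(Σ_j a_j u_j) − ½ Σ_iΣ_j a_ia_j u_iu_j (χ_i − χ_j)²`. -/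
theorem sq_localForm_cutoff_eq {ι : Type*} [Fintype ι] (a χ u : ι → ℝ) :
    (∑ i, a i * (χ i * u i)) ^ 2 =
      (∑ i, a i * (χ i ^ 2 * u i)) * (∑ j, a j * u j) -
        (1 / 2) * ∑ i, ∑ j, a i * a j * (u i * u j) * (χ i - χ j) ^ 2 := by
  -- all three terms as double sums
  have e1 : (∑ i, a i * (χ i * u i)) ^ 2 = ∑ i, ∑ j, a i * a j * (u i * u j) * (χ i * χ j) := by
    rw [sq, Finset.sum_mul_sum]
    exact Finset.sum_congr rfl fun i _ => Finset.sum_congr rfl fun j _ => by ring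
  have e2 : (∑ i, a i * (χ i ^ 2 * u i)) * (∑ j, a j * u j) = ∑ i, ∑ j, a i * a j * (u i * u j) * χ i ^ 2 := by
    rw [Finset.sum_mul_sum]
    exact Finset.sum_congr rfl fun i _ => Finset.sum_congr rfl fun j _ => by ring
  have e3 : ∑ i, ∑ j, a i * a j * (u i * u j) * (χ i - χ j) ^ 2 =
      (∑ i, ∑ j, a i * a j * (u i * u j) * χ i ^ 2) + (∑ i, ∑ j, a i * a j * (u i * u j) * χ j ^ 2) -
        2 * ∑ i, ∑ j, a i * a j * (u i * u j) * (χ i * χ j) := by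
    rw [Finset.mul_sum, ← Finset.sum_add_distrib, ← Finset.sum_sub_distrib]
    refine Finset.sum_congr rfl fun i _ => ?_
    rw [Finset.mul_sum, ← Finset.sum_add_distrib, ← Finset.sum_sub_distrib]
    exact Finset.sum_congr rfl fun j _ => by ring
  have e4 : ∑ i, ∑ j, a i * a j * (u i * u j) * χ j ^ 2 = ∑ i, ∑ j, a i * a j * (u i * u j) * χ i ^ 2 := by
    rw [Finset.sum_comm]
    exact Finset.sum_congr rfl fun i _ => Finset.sum_congr rfl fun j _ => by ring
  rw [e1, e2, e3, e4]
  ring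

/-- Finite-family version: summing the identity over a family of local functionals. -/
theorem sum_sq_localForm_cutoff_eq {ι κ : Type*} [Fintype ι] (s : Finset κ) (a : κ → ι → ℝ) (χ u : ι → ℝ) :
    ∑ l ∈ s, (∑ i, a l i * (χ i * u i)) ^ 2 =
      ∑ l ∈ s, (∑ i, a l i * (χ i ^ 2 * u i)) * (∑ j, a l j * u j) -
        (1 / 2) * ∑ l ∈ s, ∑ i, ∑ j, a l i * a l j * (u i * u j) * (χ i - χ j) ^ 2 := by
  rw [Finset.mul_sum, ← Finset.sum_sub_distrib]
  exact Finset.sum_congr rfl fun l _ => sq_localForm_cutoff_eq (a l) χ u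

/-! ## The Hodge system: bilinear form, the harmonic column, and the Caccioppoli identity -/

/-- The bilinear form of `hodgeQ`: `v·(hodgeQ w) = Σ_p (λ_p·v)(λ_p·w) + Σ_{x interior} (g_x·v)(g_x·w)`. -/
theorem dotProduct_hodgeQ_mulVec {H : ℕ} (v w : LandauFree H → ℝ) :
    v ⬝ᵥ (hodgeQ H *ᵥ w) = (∑ p ∈ hodgePlaqs H, (landauCoeff H p ⬝ᵥ v) * (landauCoeff H p ⬝ᵥ w)) +
      ∑ x ∈ interiorSites H, (gradVec H x ⬝ᵥ v) * (gradVec H x ⬝ᵥ w) := by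
  rw [hodgeQ_mulVec, dotProduct_add]
  have hA : v ⬝ᵥ (∑ p ∈ hodgePlaqs H, (landauCoeff H p ⬝ᵥ w) • landauCoeff H p) =
      ∑ p ∈ hodgePlaqs H, (landauCoeff H p ⬝ᵥ v) * (landauCoeff H p ⬝ᵥ w) := by
    rw [dotProduct_sum]
    exact Finset.sum_congr rfl fun p _ => by rw [dotProduct_smul, smul_eq_mul, dotProduct_comm v, mul_comm]
  have hB : v ⬝ᵥ (∑ x ∈ interiorSites H, (gradVec H x ⬝ᵥ w) • gradVec H x) =
      ∑ x ∈ interiorSites H, (gradVec H x ⬝ᵥ v) * (gradVec H x ⬝ᵥ w) := by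
    rw [dotProduct_sum]
    exact Finset.sum_congr rfl fun x _ => by rw [dotProduct_smul, smul_eq_mul, dotProduct_comm v, mul_comm]
  rw [hA, hB]

/-- **The column `u_{e'} = (hodgeQ⁻¹)_{e e'}` is `hodgeQ`-harmonic off `e`**: `hodgeQ u = δ_e`. -/
theorem hodgeQ_mulVec_invRow {H : ℕ} (e : LandauFree H) :
    hodgeQ H *ᵥ (fun e' => (hodgeQ H)⁻¹ e e') = Pi.single e 1 := by
  classical
  have hdet : IsUnit (hodgeQ H).det := isUnit_iff_ne_zero.2 (hodgeQ_posDef H).det_pos.ne'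
  -- `hodgeQ` is symmetric, so the row `e` of the inverse is the column `e` of the inverse
  have hsymm : (hodgeQ H)ᵀ = hodgeQ H := by
    unfold hodgeQ LatticeMaxwell.Qmat
    rw [Matrix.transpose_add, Matrix.transpose_sum, Matrix.transpose_sum]
    simp [Matrix.transpose_vecMulVec]
  have hinvsymm : ((hodgeQ H)⁻¹)ᵀ = (hodgeQ H)⁻¹ := by rw [Matrix.transpose_nonsing_inv, hsymm]
  have hcol : (fun e' => (hodgeQ H)⁻¹ e e') = fun e' => (hodgeQ H)⁻¹ e' e := by
    funext e'
    have := congrFun (congrFun hinvsymm e') e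
    rw [Matrix.transpose_apply] at this
    exact this
  rw [hcol]
  have h := Matrix.mul_nonsing_inv (hodgeQ H) hdet
  funext e'
  have h' := congrFun (congrFun h e') e
  rw [Matrix.mul_apply] at h'
  simp only [Matrix.mulVec, dotProduct]
  rw [h', Matrix.one_apply, Pi.single_apply]

/-- **The discrete Caccioppoli identity for the Hodge column.**  For every cutoff `χ` vanishing at `e`, with `u_{e'} = (hodgeQ⁻¹)_{e e'}`:
`Σ_p (λ_p·(χu))² + Σ_x (g_x·(χu))² = −½·[Σ_p Σ_iΣ_j λ_pi λ_pj u_iu_j (χ_i−χ_j)² + Σ_x Σ_iΣ_j g_xi g_xj u_iu_j (χ_i−χ_j)²]`. -/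
theorem hodge_caccioppoli_identity {H : ℕ} (e : LandauFree H) (χ : LandauFree H → ℝ) (hχ : χ e = 0) :
    (∑ p ∈ hodgePlaqs H, (∑ i, landauCoeff H p i * (χ i * (hodgeQ H)⁻¹ e i)) ^ 2) +
      ∑ x ∈ interiorSites H, (∑ i, gradVec H x i * (χ i * (hodgeQ H)⁻¹ e i)) ^ 2 =
      -(1 / 2) * ((∑ p ∈ hodgePlaqs H, ∑ i, ∑ j,
          landauCoeff H p i * landauCoeff H p j * ((hodgeQ H)⁻¹ e i * (hodgeQ H)⁻¹ e j) * (χ i - χ j) ^ 2) +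
        ∑ x ∈ interiorSites H, ∑ i, ∑ j,
          gradVec H x i * gradVec H x j * ((hodgeQ H)⁻¹ e i * (hodgeQ H)⁻¹ e j) * (χ i - χ j) ^ 2) := by
  -- the cross terms assemble to `(χ²u)·(hodgeQ u) = (χ²u)·δ_e = χ_e² u_e = 0`
  have hz : (fun i => χ i ^ 2 * (hodgeQ H)⁻¹ e i) ⬝ᵥ (hodgeQ H *ᵥ fun e' => (hodgeQ H)⁻¹ e e') = 0 := by
    rw [hodgeQ_mulVec_invRow e, dotProduct_single, hχ]
    ring
  have hcross : (∑ p ∈ hodgePlaqs H, (∑ i, landauCoeff H p i * (χ i ^ 2 * (hodgeQ H)⁻¹ e i)) *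
        (∑ j, landauCoeff H p j * (hodgeQ H)⁻¹ e j)) +
      ∑ x ∈ interiorSites H, (∑ i, gradVec H x i * (χ i ^ 2 * (hodgeQ H)⁻¹ e i)) *
        (∑ j, gradVec H x j * (hodgeQ H)⁻¹ e j) = 0 := by
    have h := dotProduct_hodgeQ_mulVec (fun i => χ i ^ 2 * (hodgeQ H)⁻¹ e i) (fun e' => (hodgeQ H)⁻¹ e e')
    rw [hz] at h
    simp only [dotProduct] at h
    linarith
  have key1 := sum_sq_localForm_cutoff_eq (hodgePlaqs H) (fun p => landauCoeff H p) χ (fun i => (hodgeQ H)⁻¹ e i)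
  have key2 := sum_sq_localForm_cutoff_eq (interiorSites H) (fun x => gradVec H x) χ (fun i => (hodgeQ H)⁻¹ e i)
  beta_reduce at key1 key2
  rw [key1, key2]
  linarith

/-! ## Appendix (same seat, appended): bounding the commutator double sum of one local functional

The form in which a Lipschitz cutoff yields the `r⁻²` of `HodgeCaccioppoli`: if the local functional `a` is supported in `S` with `|a| ≤ A`
and `|χ_i − χ_j| ≤ κ` on `S × S`, then `|Σ_iΣ_j a_ia_j u_iu_j (χ_i − χ_j)²| ≤ κ²·A²·#S·Σ_{i∈S} u_i²`.  For `hodgeQ`: `A = 2`, `#S ≤ 4` for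
`λ_p` (`LatticeMaxwell.abs_coeffAux_le`, `coeffAux_eq_zero`) and `A = 1`, `#S ≤ 8` for `g_x`; `κ = 2·Lip(χ)` since supports have ℓ¹-diameter `≤ 2`. -/

/-- **Commutator bound for one local functional.**  If `a` is supported in `S` with `|a_i| ≤ A`, and the cutoff varies by at most `κ`
across `S` (`|χ_i − χ_j| ≤ κ` for `i, j ∈ S`), then
`|Σ_iΣ_j a_ia_j u_iu_j (χ_i − χ_j)²| ≤ κ²·A²·#S·Σ_{i ∈ S} u_i²`. -/
theorem abs_commutator_sum_le {ι : Type*} [Fintype ι] [DecidableEq ι] (a χ u : ι → ℝ) (S : Finset ι) {A κ : ℝ}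
    (hA : 0 ≤ A) (hsupp : ∀ i, i ∉ S → a i = 0) (habs : ∀ i, |a i| ≤ A)
    (hχ : ∀ i ∈ S, ∀ j ∈ S, |χ i - χ j| ≤ κ) :
    |∑ i, ∑ j, a i * a j * (u i * u j) * (χ i - χ j) ^ 2| ≤ κ ^ 2 * A ^ 2 * #S * ∑ i ∈ S, u i ^ 2 := by
  -- restrict both sums to `S`
  have hrestrict : ∑ i, ∑ j, a i * a j * (u i * u j) * (χ i - χ j) ^ 2 =
      ∑ i ∈ S, ∑ j ∈ S, a i * a j * (u i * u j) * (χ i - χ j) ^ 2 := by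
    rw [← Finset.sum_subset (Finset.subset_univ S)]
    · refine Finset.sum_congr rfl fun i _ => ?_
      rw [← Finset.sum_subset (Finset.subset_univ S)]
      intro j _ hj
      rw [hsupp j hj]; ring
    · intro i _ hi
      refine Finset.sum_eq_zero fun j _ => ?_
      rw [hsupp i hi]; ring
  rw [hrestrict]
  -- termwise: `|a_ia_j u_iu_j (χ_i−χ_j)²| ≤ κ²A² · (u_i² + u_j²)/2`
  have hterm : ∀ i ∈ S, ∀ j ∈ S, |a i * a j * (u i * u j) * (χ i - χ j) ^ 2| ≤ κ ^ 2 * A ^ 2 * ((u i ^ 2 + u j ^ 2) / 2) := by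
    intro i hi j hj
    have h1 : |a i| ≤ A := habs i
    have h2 : |a j| ≤ A := habs j
    have h3 : |χ i - χ j| ≤ κ := hχ i hi j hj
    have h4 : |u i * u j| ≤ (u i ^ 2 + u j ^ 2) / 2 := by
      rw [abs_mul]
      nlinarith [sq_nonneg (|u i| - |u j|), sq_abs (u i), sq_abs (u j), abs_nonneg (u i), abs_nonneg (u j)]
    have h5 : (χ i - χ j) ^ 2 ≤ κ ^ 2 := by
      rw [← sq_abs]; exact pow_le_pow_left₀ (abs_nonneg _) h3 2
    rw [abs_mul, abs_mul, abs_mul, abs_of_nonneg (sq_nonneg (χ i - χ j))]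
    have hAA : |a i| * |a j| ≤ A * A := mul_le_mul h1 h2 (abs_nonneg _) hA
    calc |a i| * |a j| * |u i * u j| * (χ i - χ j) ^ 2 ≤ (A * A) * ((u i ^ 2 + u j ^ 2) / 2) * κ ^ 2 := by
          refine mul_le_mul (mul_le_mul hAA h4 (abs_nonneg _) (by positivity)) h5 (sq_nonneg _) (by positivity)
      _ = κ ^ 2 * A ^ 2 * ((u i ^ 2 + u j ^ 2) / 2) := by ring
  calc |∑ i ∈ S, ∑ j ∈ S, a i * a j * (u i * u j) * (χ i - χ j) ^ 2|
      ≤ ∑ i ∈ S, |∑ j ∈ S, a i * a j * (u i * u j) * (χ i - χ j) ^ 2| := Finset.abs_sum_le_sum_abs _ _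
    _ ≤ ∑ i ∈ S, ∑ j ∈ S, |a i * a j * (u i * u j) * (χ i - χ j) ^ 2| :=
        Finset.sum_le_sum fun i _ => Finset.abs_sum_le_sum_abs _ _
    _ ≤ ∑ i ∈ S, ∑ j ∈ S, κ ^ 2 * A ^ 2 * ((u i ^ 2 + u j ^ 2) / 2) :=
        Finset.sum_le_sum fun i hi => Finset.sum_le_sum fun j hj => hterm i hi j hj
    _ = κ ^ 2 * A ^ 2 * #S * ∑ i ∈ S, u i ^ 2 := by
        have hsplit : ∑ i ∈ S, ∑ j ∈ S, κ ^ 2 * A ^ 2 * ((u i ^ 2 + u j ^ 2) / 2) =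
            κ ^ 2 * A ^ 2 / 2 * (∑ i ∈ S, ∑ j ∈ S, u i ^ 2 + ∑ i ∈ S, ∑ j ∈ S, u j ^ 2) := by
          rw [← Finset.sum_add_distrib, Finset.mul_sum]
          refine Finset.sum_congr rfl fun i _ => ?_
          rw [← Finset.sum_add_distrib, Finset.mul_sum]
          exact Finset.sum_congr rfl fun j _ => by ring
        rw [hsplit]
        have h1 : ∑ i ∈ S, ∑ _j ∈ S, u i ^ 2 = #S * ∑ i ∈ S, u i ^ 2 := by
          rw [Finset.mul_sum]
          exact Finset.sum_congr rfl fun i _ => by rw [Finset.sum_const, nsmul_eq_mul]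
        have h2 : ∑ _i ∈ S, ∑ j ∈ S, u j ^ 2 = #S * ∑ j ∈ S, u j ^ 2 := by
          rw [Finset.sum_const, nsmul_eq_mul]
        rw [h1, h2]
        ring

end Summit.QuantumFields.YangMills.Theorems.AllWindowsColdBoxBoxHighLine

end
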